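import Summits.QuantumAdvantage.AdviceFreeQNC0.TwistBoundX3LocalProof
import HarnessLib

/-!
# Cell qa-qnc0, `p = 3` — Theorem 36.U of planner qa-qnc0-p2 g36 (`BlockPartitionTwistBound3`) as a COROLLARY of
`twistBoundX3Local` (prover qn-prover-3 g22)

Planner qa-qnc0-p2 g36 (ROUND-36P2 §4.4, `HOME/qa-qnc0-p2/exp36p2/TwistedJunta36.lean`, typed VERBATIM below, "PAPER-PROVED with a
computed constant, not formalised") states: for bells reading only their own length-`b` BLOCK, the twisted win sum decays in the NUMBER OF
TWISTED BLOCKS, `‖T(β)‖ ≤ C₀·θ_b^{#twisted blocks}·2^N`, `θ_b < 1` (`b ≥ 4`).  In its typed (qualitative) form this is a one-line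
corollary of `BondTwist3.twistBoundX3Local` (`TwistBoundX3LocalProof.lean`): a block-reading rule is `(b−1)`-local in the cyclic sense
(`isLocalRule_of_readsBlock`), `#supp β ≥ #twisted blocks` (`card_twistedBlocks_le`), and `ρ^{#supp β} ≤ ρ^{#twisted blocks}` for the
sign-normalised `0 ≤ ρ < 1` of `twist_params` — for EVERY `b` (the planner's `4 ≤ b` is not needed).  The planner's quantitative content
(`θ_4 = 0.9222`, …, fully twisted blocks `↓ 2/3`, speakers `4/9` from below) is NOT reproduced: the constant here is the compactness
constant of `blockOpR_contracts` at radius `b − 1`.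

WHAT THIS IS NOT: no explicit rate; nothing on scattered juntas ((R1) `TwistedJuntaBoundX3S` open); crux 22907 untouched; separation NOT moved.
-/

noncomputable section

namespace Summit.QuantumAdvantage.AdviceFreeQNC0

open Finset Literature.Computability.MetaComplexity Literature.Computability.QuantumComplexity
open Literature.Computability.QuantumComplexity.RingHLF

namespace TwistedJunta36

open BondTwist3

/-- **`BlockPartitionTwistBound3`** (Theorem 36.U of ROUND-36P2 §4.4, planner qa-qnc0-p2 g36; statement VERBATIM from
`exp36p2/TwistedJunta36.lean`): for bells that read only their own length-`b` block (`y`-frame: output `= tGuess ⊕ f k x` with `f k` a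
`B(k)`-junta), the twisted win-sum decays in the NUMBER OF TWISTED BLOCKS: `‖T(β)‖ ≤ C₀·θ_b^{#{m : β|B_m ≠ 0}}·2^N` with `θ_b < 1` for
every `b ≥ 4`.  (Planner's paper proof: parity-character decomposition of the exact 12-state block chain with explicit `θ_b`; here: PROVED
qualitatively for every `b` as a corollary of `twistBoundX3Local`, `blockPartitionTwistBound3`.) -/
def BlockPartitionTwistBound3 : Prop :=
  open scoped Classical in
  ∀ b : ℕ, 4 ≤ b → ∃ θ : ℝ, θ < 1 ∧ ∃ C₀ : ℝ, ∀ M : ℕ, ∀ f : Fin (b * M) → (Fin (b * M) → Bool) → Bool,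
    (∀ k (x x' : Fin (b * M) → Bool), (∀ i : Fin (b * M), i.val / b = k.val / b → x i = x' i) → f k x = f k x') →
    ∀ β : Fin (b * M) → ZMod 3,
      ‖∑ x : Fin (b * M) → Bool, (ZMod.stdAddChar (∑ i : Fin (b * M), if x i then β i else 0) : ℂ) *
          (if (OddZeros x ∧ RingHLF.Rel x (fun k => xor (tGuess x k) (f k x))) then (1 : ℂ) else 0)‖
        ≤ C₀ * θ ^ (univ.filter fun m : Fin M => ∃ i : Fin (b * M), i.val / b = m.val ∧ β i ≠ 0).card * (2 : ℝ) ^ (b * M)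

/-- Two positions in the same length-`b` block (`b ≥ 1`) are at cyclic distance `≤ b − 1`. -/
theorem cycNear_of_sameBlock {N b : ℕ} (hb : 0 < b) (i k : Fin N) (h : i.val / b = k.val / b) : CycNear N (b - 1) i k := by
  have hi := i.isLt
  have hk := k.isLt
  have h1 := Nat.div_add_mod i.val b
  have h2 := Nat.div_add_mod k.val b
  have h3 := Nat.mod_lt i.val hb
  have h4 := Nat.mod_lt k.val hb
  rw [h] at h1
  generalize b * (k.val / b) = P at h1 h2
  unfold CycNear
  rcases le_or_gt k.val i.val with hle | hlt
  · left
    have e : (i.val + N - k.val) % N = i.val - k.val := by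
      rw [show i.val + N - k.val = (i.val - k.val) + N by omega, Nat.add_mod_right, Nat.mod_eq_of_lt (by omega)]
    rw [e]; omega
  · right
    have e : (k.val + N - i.val) % N = k.val - i.val := by
      rw [show k.val + N - i.val = (k.val - i.val) + N by omega, Nat.add_mod_right, Nat.mod_eq_of_lt (by omega)]
    rw [e]; omega

/-- A block-reading rule is `(b−1)`-local. -/
theorem isLocalRule_of_readsBlock {b M : ℕ} (f : Fin (b * M) → (Fin (b * M) → Bool) → Bool)
    (hf : ∀ k (x x' : Fin (b * M) → Bool), (∀ i : Fin (b * M), i.val / b = k.val / b → x i = x' i) → f k x = f k x') :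
    IsLocalRule (b * M) (b - 1) f := by
  intro x x' k hxx'
  rcases Nat.eq_zero_or_pos b with hb | hb
  · exact absurd k.isLt (by subst hb; simp)
  · exact hf k x x' fun i hi => hxx' i (cycNear_of_sameBlock hb i k hi)

open scoped Classical in
/-- The twisted blocks are at most as many as the twisted letters. -/
theorem card_twistedBlocks_le {b M : ℕ} (β : Fin (b * M) → ZMod 3) :
    (univ.filter fun m : Fin M => ∃ i : Fin (b * M), i.val / b = m.val ∧ β i ≠ 0).card ≤
      (univ.filter fun i : Fin (b * M) => β i ≠ 0).card := by
  classical
  have hsub : (univ.filter fun m : Fin M => ∃ i : Fin (b * M), i.val / b = m.val ∧ β i ≠ 0) ⊆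
      (univ.filter fun i : Fin (b * M) => β i ≠ 0).image fun i => (⟨i.val / b, Nat.div_lt_of_lt_mul i.isLt⟩ : Fin M) := by
    intro m hm
    rw [mem_filter] at hm
    obtain ⟨i, hi, hβ⟩ := hm.2
    rw [mem_image]
    exact ⟨i, mem_filter.2 ⟨mem_univ _, hβ⟩, Fin.ext hi⟩
  exact (card_le_card hsub).trans card_image_le

/-- **Theorem 36.U (`BlockPartitionTwistBound3`) — PROVED**, for every block length, as a corollary of `twistBoundX3Local`. -/
theorem blockPartitionTwistBound3 : BlockPartitionTwistBound3 := by
  classical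
  intro b _hb
  obtain ⟨A, ρ, hA, hρ0, hρ1, h⟩ := twist_params twistBoundX3Local (b - 1)
  refine ⟨ρ, hρ1, A, fun M f hf β => ?_⟩
  refine (h (b * M) f (isLocalRule_of_readsBlock f hf) β).trans ?_
  exact mul_le_mul_of_nonneg_right
    (mul_le_mul_of_nonneg_left (pow_le_pow_of_le_one hρ0 hρ1.le (card_twistedBlocks_le β)) hA) (by positivity)

end TwistedJunta36

end Summit.QuantumAdvantage.AdviceFreeQNC0

end
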